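import Literature.AlgebraicGeometry.Resolution.BlowupDisjointCentreSplitting
import Literature.AlgebraicGeometry.Resolution.BlowupsScaling
import Literature.AlgebraicGeometry.Resolution.AffineBlowupUnique
import HarnessLib

/-!
# BED Ω, GLOBAL PATCH (g-b), F4 (a): THE FLOOR `Bl_{I′} X`, `I′ = L³ + g·L²`, IS ONE AFFINE BLOW-UP AND FACTORS THROUGH THE CLASS MODEL `X̃ = Bl_L X` AS A BLOWING UP ALONG
# `𝒥 = (L + (g))·𝒪_{X̃}`, COSUPPORTED OVER `V(L)` — the scheme-level form of idea-1ʼs Ω-L1 (`I′ = L²·(L + (g))`, Stacks 080A)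
# (crux `FInjectiveMacaulayfication` stmt-ResolutionOfSingularities-15315, chain w45a; res-L1-w45a-plan-1 RULINGS R23.15/R23.16 (r1) «(g-b) scheme-level descent = stub-3», R23.23 (1)
# kernel file list F4; res-L1-w45a-idea-1 g30 `Q17-r0.md` §Ω1 Ω-L1; seat res-L1-w45a-stub-3 g13)

[OURS · L1 W4.5a] Support file (`--supports stmt-ResolutionOfSingularities-15315 --as helper`); theorems only; GENERIC (any commutative ring `R`, any ideal `L`, any `g`); no named fact;
NOT a statement of any manuscript; nothing of the crux is proved. The Ω₁ instance (`R = k[x,y,u,t,z]/(z² + x⁹ + y⁹ + u⁹ + t⁹)`, `L = 𝔪·K` the class centre of ✓ `B9PointFloorRowClass`,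
`g = x·u² − y³`, `a = 1`) is a one-line application left to the file that fixes the vertex support `V(L) = {v}` (F4 continued). AI-written (AI review is weaker than expert review).

THE STATEMENT. For `I′ := L³ + (g)·L²` (`= L²·(L + (g))` as ideals): the affine blow-up `π′ : Bl_{I′}(Spec R) → Spec R` (✓ `affineBlowup.isBlowup`) factors as `π′ = τ ≫ π_L` with
`π_L : X̃ = Bl_L(Spec R) → Spec R` and `τ : Bl_{I′} → X̃` A BLOWING UP OF `X̃` ALONG `𝒥 := π_L^{-1}(L + (g))~·𝒪_{X̃}` (✓ `IsBlowup.exists_fac_of_mul`, Stacks 080A read backwards, with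
`π_L` a blow-up along `L~·L~` by ✓ `IsBlowup.comp` ∘ ✓ `IsBlowup.id`), and `supp 𝒥 ⊆ π_L⁻¹(V(L))` (✓ `support_comap`, ✓ `affineBlowup.support_idealSheaf`): the second centre is
COSUPPORTED IN THE EXCEPTIONAL LOCUS — the shape (`π`, `𝒥`, `h𝒥fib`) that ✓p703009 `CompositeFloorAdmissible.admissible_of_composite` consumes.
* `ideal_floor_eq_mul` (`L³ + (g)L² = (L·L)·(L + (g))`), `isBlowup_affineBlowup_mul_self` (`Bl_L` is a blow-up along `L~·L~`), ★★ `exists_floor_fac_classModel`.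
[cite: StacksProject, Tag 080A; GortzWedhorn2020, Prop. 13.92 and (13.19)]
-/

set_option linter.dupNamespace false

noncomputable section

open AlgebraicGeometry CategoryTheory Literature.AlgebraicGeometry.Resolution

namespace Summit.ResolutionOfSingularities.ResolutionOfSingularities.Theorems.FInjectiveMacaulayfication.OmegaFloorFactorsThroughClassModel

universe u

variable {R : Type u} [CommRing R] (L : Ideal R) (g : R)

/-- `L³ + (g)·L² = (L·L)·(L + (g))` (idea-1ʼs Ω-L1 identity `I′ = L²(L^a + (g))` at `a = 1`). [plumbing] -/
theorem ideal_floor_eq_mul : L ^ 3 + Ideal.span {g} * L ^ 2 = (L * L) * (L + Ideal.span {g}) := by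
  ring

/-- **`Bl_L(Spec R) → Spec R` is also a blowing up along `L~ · L~`** (080A with the identity as the second blow-up: `L~·𝒪_{Bl_L}` is effective Cartier). [cite: StacksProject, Tag 080A;
GortzWedhorn2020, (13.19)] -/
theorem isBlowup_affineBlowup_mul_self : IsBlowup (affineBlowup.π L) (affineBlowup.idealSheaf L * affineBlowup.idealSheaf L) := by
  have h := affineBlowup.isBlowup L
  have h2 := IsBlowup.comp h (IsBlowup.id h.isEffectiveCartier)
  rwa [Category.id_comp] at h2

/-- ★★ **THE FLOOR `Bl_{L³ + (g)L²}(Spec R)` FACTORS THROUGH THE CLASS MODEL `Bl_L(Spec R)` AS A BLOWING UP ALONG `(L + (g))·𝒪`, COSUPPORTED OVER `V(L)`.** For every commutative ring `R`,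
ideal `L` and element `g`: there is `τ : Bl_{I′} → Bl_L` with `τ ≫ π_L = π_{I′}`, `τ` a blowing up of `Bl_L` along `𝒥 = (L + (g))~.comap π_L`, and `supp 𝒥 ⊆ π_L⁻¹(V(L))`.
[OURS · BED Ω (g-b) F4 (a); cite: StacksProject, Tag 080A] -/
theorem exists_floor_fac_classModel :
    ∃ τ : affineBlowup (L ^ 3 + Ideal.span {g} * L ^ 2) ⟶ affineBlowup L,
      IsBlowup τ ((affineBlowup.idealSheaf (L + Ideal.span {g})).comap (affineBlowup.π L)) ∧
      τ ≫ affineBlowup.π L = affineBlowup.π (L ^ 3 + Ideal.span {g} * L ^ 2) ∧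
      ((((affineBlowup.idealSheaf (L + Ideal.span {g})).comap (affineBlowup.π L)).support : Set (affineBlowup L)) ⊆
        (affineBlowup.π L).base ⁻¹' (PrimeSpectrum.zeroLocus (L : Set R))) := by
  have hS := affineBlowup.isBlowup (L ^ 3 + Ideal.span {g} * L ^ 2)
  have hI : affineBlowup.idealSheaf (L ^ 3 + Ideal.span {g} * L ^ 2) =
      (affineBlowup.idealSheaf L * affineBlowup.idealSheaf L) * affineBlowup.idealSheaf (L + Ideal.span {g}) := by
    rw [ideal_floor_eq_mul, affineBlowup.idealSheaf_mul, affineBlowup.idealSheaf_mul]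
  rw [hI] at hS
  obtain ⟨τ, hτ, hfac⟩ := hS.exists_fac_of_mul (isBlowup_affineBlowup_mul_self L)
  refine ⟨τ, hτ, hfac, ?_⟩
  rw [Scheme.IdealSheafData.support_comap]
  intro x hx
  have hx' : (affineBlowup.π L).base x ∈ ((affineBlowup.idealSheaf (L + Ideal.span {g})).support : Set (Spec (.of R))) := hx
  rw [affineBlowup.support_idealSheaf] at hx'
  exact PrimeSpectrum.zeroLocus_anti_mono (show (L : Set R) ⊆ (L + Ideal.span {g} : Ideal R) from fun r hr => Ideal.mem_sup_left hr) hx'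

end Summit.ResolutionOfSingularities.ResolutionOfSingularities.Theorems.FInjectiveMacaulayfication.OmegaFloorFactorsThroughClassModel

end
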